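import Literature.Geometry.Kaehler.ComplexTorusHodgeGroupProductLieAlgebraGoursat
import Literature.Geometry.Kaehler.ComplexTorusHodgeGroupProductLiePerfectSolvable
import HarnessLib

/-!
# Products with a factor whose Hodge group is ONE-DIMENSIONAL (`dim Hg(X₂) = 1`, e.g. an elliptic curve with complex
# multiplication): `Hg(X₁ × X₂) = Hg(X₁) × Hg(X₂)` or `K₂` is finite; then `Lie Hg(X₁ × X₂)(ℂ) ≅ Lie Hg(X₁)(ℂ)` and the
# CENTRE of `𝔥𝔤_ℂ(X₁)` surjects onto (and contains a copy of) `𝔥𝔤_ℂ(X₂)` — Moonen–Zarhin's Lemma (3.6) ∕ Prop. (3.8) mechanism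

Layer `Literature/Geometry/Kaehler`, namespace `Literature.Geometry.Kaehler.ComplexTorus`; lane `lit-hodgefound` (Track 2
foundations library), Layer A3/A4; prover seat `lit-hodgefound-p17` (generation 41, self-proposed row g41-#6), sequel of
`ComplexTorusHodgeGroupProductLieAlgebraGoursat` (g40-#7: the block projections `r₁`, `r₂` of `Lie Hg(X₁ × X₂)(ℂ)`,
`exists_lieHom_toBlocks`), `ComplexTorusHodgeGroupProductLiePerfectSolvable` (g41-#2: perfect × solvable splits; Moonen–Zarhin
(3.6) as the inequality `dim Hg(X₁) + dim Hg(X₂) ≤ dim Hg(X₁ × X₂) + dim 𝔷(𝔥𝔤_ℂ X₁)`) and, in statement only,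
`ComplexTorusHodgeGroupProductLieKernels` (g41-#5: `K₂` finite ⟺ `Lie Hg(X₁ × X₂)(ℂ) ≅ Lie Hg(X₁)(ℂ)`).  THEOREMS ONLY (no
definition, no instance, no notation, no named fact; D-0026 net debt 0).

DICTIONARY.  `G = Hg(X₁ × X₂)(ℂ)`, `Gᵢ = Hg(Xᵢ)(ℂ)` (in `GL` through `toGL`), `dim = zdim` (Springer), `Lie Gᵢ = lieSubalgebraGL`,
`K₁ = hodgeGroupCProdInl = {s | (s 0; 0 1) ∈ G}`, `K₂ = hodgeGroupCProdInr`.  The hypothesis of this file is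
`dim Hg(X₂) = 1`: by `coe_mumfordTateGroup_eq_range_hodgeSGL_iff_zdim_eq_one` (`ComplexTorusHodgeGroupDimensionBounds`) this
says `MT(X₂) = h(ℂ^×)`, the situation of an elliptic curve with complex multiplication (Moonen–Zarhin (3.8): "`Hg(E)` is the
rank 1 torus `U_k`"); it is the complex-points shadow of "`Hg(X₂)` is a `ℚ`-simple algebraic torus" of Lemma (3.6) in rank one.
A one-dimensional Zariski-connected group has no Zariski-connected closed subgroups other than `1` and itself (Springer 1.8.2),
so `Hg(X₂)(ℂ)` is "almost simple" in the sense of `ComplexTorusHodgeGroupProductDimensionSplitting` §3 and `K₂° = 1` or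
`K₂ = Hg(X₂)(ℂ)`.

## Sources, verbatim

* B. Moonen, Yu. G. Zarhin [MoonenZarhin1999LowDim], *Hodge classes on abelian varieties of low dimension*, Math. Ann. 315
  (1999), held `paper:arxiv-math_9901113`. §3 Lemma (3.6) (p0007 L16–L28): "Let `X₁` and `X₂` be nonzero complex abelian
  varieties. Assume that the Hodge group `Hg(X₂)` is a `ℚ`-simple algebraic torus. (In particular `X₂` is of CM-type.) Write
  `X = X₁ × X₂`. If `Hg(X) ≠ Hg(X₁) × Hg(X₂)` then the center of `Hg(X₁)` contains an algebraic torus which is `ℚ`-isogenous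
  to `Hg(X₂)`. […] we then have that `𝔥𝔤(X) = 𝔤₁ ⊕ 𝔤₃ ≅ 𝔥𝔤(X₁)` and `𝔥𝔤(X₂) ≅ 𝔤₃`."; Proposition (3.8) (p0007 L55–L73):
  "Let `X` be an abelian variety and let `E` be an elliptic curve, both over `ℂ`. Suppose `Hom(E, X) = 0`. Then either
  `Hg(X × E) = Hg(X) × Hg(E)` or `End⁰(E) = k` is an imaginary quadratic field such that there exists an embedding of `k` into
  the center of `End⁰(X)`. […] `Hg(E)` is the rank 1 torus `U_k`. […] if `Hg(X × E) ≠ Hg(X) × Hg(E)` then there is a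
  homomorphism `U_k → U_{F₁} × ⋯ × U_{F_n}` [into the center `Z` of `Hg(X)`] with finite kernel."; §3 (3.1) (p0006 L25–L60).
* B. B. Gordon [Gordon1997], *A survey of the Hodge conjecture for abelian varieties*, held `paper:arxiv-alg-geom_9709030`,
  §2.16 Proposition (Goursat's Lemma), first bullet (p0012 L112–L119).
* T. A. Springer [Springer1998], *Linear Algebraic Groups*, 2nd ed.: 1.8.2 (a proper closed irreducible subset has smaller
  dimension), 2.2.1 (`G°` has finite index; finite ⟺ `G° = 1`), 4.4.5–4.4.7 (`dim Lie G = dim G`), 5.3.2.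
* J. E. Humphreys [Humphreys1972], *Introduction to Lie Algebras and Representation Theory*, §1.4 (p0025: Lie algebras of
  dimension `1` are abelian), §19.1 Proposition (a) (reductive: `L = Z(L) ⊕ [L, L]`).

## What is proved

* §0 (namespace `Literature.NumberTheory.Automorphic`, any perfect field): `IsZConnected.eq_bot_of_zdim_eq_zero`,
  `IsZConnected.zdim_eq_zero_iff`, **`IsZConnected.eq_bot_or_eq_of_zdim_le_one`** (a Zariski-connected `M ≤ H` with
  `dim H ≤ 1` is `1` or `H`).
* §1 ONE TORUS with `dim Hg(X) ≤ 1`: `almostSimple_map_toGL_hodgeGroupC_of_zdim_le_one`,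
  **`isLieAbelian_lieSubalgebraGL_hodgeGroupC_of_zdim_le_one`**, `isSolvable_…`, **`hodgeGroup_comm_of_zdim_le_one`**
  (`Hg(X)` is commutative), `hodgeGroupC_comm_of_zdim_le_one`, `isLieAbelian_hodgeGroupComplexLie_of_zdim_le_one`.
* §2 PRODUCTS, GROUP LEVEL (`dim Hg(X₂) = 1`): **`hodgeGroupC_prod_eq_blockDiagProd_or_finite_hodgeGroupCProdInr_of_zdim_eq_one`**
  (split or `K₂` finite), `zdim_prod_eq_add_one_or_eq_of_zdim_eq_one` (`dim Hg(X₁ × X₂) ∈ {dim Hg(X₁) + 1, dim Hg(X₁)}`),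
  `not_finite_hodgeGroupCProdInr_of_prod_eq_of_zdim_ne_zero`,
  **`hodgeGroupC_prod_ne_blockDiagProd_iff_finite_hodgeGroupCProdInr_of_zdim_eq_one`** (non-split ⟺ `K₂` finite ⟺
  `dim Hg(X₁ × X₂) = dim Hg(X₁)`), mirrors for `dim Hg(X₁) = 1`, and two one-dimensional factors
  (`zdim_prod_eq_one_or_eq_two`, split ⟺ `dim = 2`).
* §3 SPLITTING CRITERIA with `dim Hg(X₂) ≤ 1` (from g41-#2, `Lie Hg(X₂)(ℂ)` being abelian):
  **`hodgeGroupC_prod_eq_blockDiagProd_of_derivedSeries_eq_top_of_zdim_le_one`** (`Lie Hg(X₁)(ℂ)` perfect ⟹ split),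
  `…_of_isSemisimple_of_zdim_le_one`, **`IsRiemannForm.hodgeGroupC_prod_eq_blockDiagProd_of_center_eq_bot_of_zdim_le_one`**
  (`𝔷(𝔥𝔤_ℂ X₁) = 0` ⟹ split), real points, (D)-transfer, and the contrapositives `derivedSeries_lieSubalgebraGL_ne_top_of_ne_of_zdim_le_one`,
  `IsRiemannForm.center_hodgeGroupComplexLie_ne_bot_of_ne_of_zdim_le_one`.
* §4 THE CENTRE SURJECTS (Moonen–Zarhin (3.6), complex Lie form, ARBITRARY tori): for `Lie Hg(X₁)(ℂ)` reductive,
  `Lie Hg(X₂)(ℂ)` solvable and `K₂` finite, **`exists_surjective_lieHom_center_of_finite_hodgeGroupCProdInr`**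
  (`𝔷(Lie Hg(X₁)(ℂ)) ↠ Lie Hg(X₂)(ℂ)`), **`exists_injective_lieHom_center_of_finite_hodgeGroupCProdInr`** (the centre of
  `Lie Hg(X₁)(ℂ)` CONTAINS A COPY of `Lie Hg(X₂)(ℂ)` — "the center of `Hg(X₁)` contains an algebraic torus isogenous to
  `Hg(X₂)`"), `finrank_le_finrank_center_of_finite_hodgeGroupCProdInr`; the polarised forms
  `IsRiemannForm.exists_surjective_lieHom_center_hodgeGroupComplexLie_of_finite_hodgeGroupCProdInr` ∕ `…injective…`,
  `IsRiemannForm.zdim_le_finrank_center_hodgeGroupComplexLie_of_finite_hodgeGroupCProdInr`; and the non-split one-dimensional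
  case **`IsRiemannForm.exists_injective_lieHom_center_hodgeGroupComplexLie_of_ne_of_zdim_eq_one`** (Prop. (3.8) shadow:
  `X × E` non-split ⟹ `𝔥𝔤_ℂ(E) ↪ 𝔷(𝔥𝔤_ℂ X)`).  (The isomorphism `Lie Hg(X × E)(ℂ) ≅ Lie Hg(X)(ℂ)` of the non-split case is
  `finite_hodgeGroupCProdInr_iff_nonempty_lieEquiv` of `ComplexTorusHodgeGroupProductLieKernels` fed with
  `hodgeGroupC_prod_ne_blockDiagProd_iff_finite_hodgeGroupCProdInr_of_zdim_eq_one`; that file is not imported here.)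

## References

* [MoonenZarhin1999LowDim] B. Moonen, Yu. G. Zarhin, Math. Ann. 315 (1999), §3 (3.1), Lemma (3.6), Proposition (3.8).
* [Gordon1997] B. B. Gordon, *A survey of the Hodge conjecture for abelian varieties*, §2.16 Proposition.
* [Springer1998] T. A. Springer, *Linear Algebraic Groups*, 2nd ed. (1998), 1.8.2, 2.2.1, 4.4.5–4.4.7, 5.3.2.
* [Humphreys1972] J. E. Humphreys, *Introduction to Lie Algebras and Representation Theory*, §1.4, §19.1.
-/

noncomputable section

open Matrix Module

/-! ### §0 One-dimensional Zariski-connected groups have no proper non-trivial Zariski-connected closed subgroups -/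

namespace Literature.NumberTheory.Automorphic

variable {k : Type*} [Field k] {n : Type*} [Fintype n] [DecidableEq n] {H M : Subgroup (GL n k)}

/-- **A Zariski-connected group of dimension `0` is trivial** (`dim 1 = 0` and connected closed subgroups `1 ≤ H` of the same
dimension are equal). [cite: Springer1998, 1.8.2 and 4.4.6] -/
theorem IsZConnected.eq_bot_of_zdim_eq_zero [PerfectField k] (hH : IsZConnected H) (h : hH.zdim = 0) : H = ⊥ := by
  have hb : (isZConnected_bot (n := n) (k := k)).zdim = 0 := by
    rw [← (isZConnected_bot (n := n) (k := k)).finrank_lieAlgebraGL_eq.2, lieAlgebraGL_bot, finrank_bot]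
  exact ((isZConnected_bot (n := n) (k := k)).eq_of_le_of_zdim_eq hH bot_le (hb.trans h.symm)).symm

/-- `dim H = 0 ⟺ H = 1` for Zariski-connected `H`. [cite: Springer1998, 1.8.2 and 4.4.6] -/
theorem IsZConnected.zdim_eq_zero_iff [PerfectField k] (hH : IsZConnected H) : hH.zdim = 0 ↔ H = ⊥ := by
  refine ⟨hH.eq_bot_of_zdim_eq_zero, fun h ↦ ?_⟩
  subst h
  rw [← hH.finrank_lieAlgebraGL_eq.2, lieAlgebraGL_bot, finrank_bot]

/-- **A ZARISKI-CONNECTED `M ≤ H` WITH `dim H ≤ 1` IS `1` OR `H`**: `dim M ≤ dim H ≤ 1`, and `dim M = 0 ⟹ M = 1`,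
`dim M = dim H ⟹ M = H` (Springer 1.8.2). In particular a one-dimensional connected group is "almost simple" in the sense of
`ComplexTorusHodgeGroupProductDimensionSplitting` §3 (no normality needed). [cite: Springer1998, 1.8.2 and 2.2.1] -/
theorem IsZConnected.eq_bot_or_eq_of_zdim_le_one [PerfectField k] (hH : IsZConnected H) (h1 : hH.zdim ≤ 1)
    (hM : IsZConnected M) (hMH : M ≤ H) : M = ⊥ ∨ M = H := by
  have hle := hM.zdim_le_of_le hH hMH
  rcases Nat.eq_zero_or_pos hM.zdim with h0 | hpos
  · exact Or.inl (hM.eq_bot_of_zdim_eq_zero h0)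
  · exact Or.inr (hM.eq_of_le_of_zdim_eq hH hMH (by omega))

end Literature.NumberTheory.Automorphic

namespace Literature.Geometry.Kaehler

namespace ComplexTorus

open Literature.NumberTheory.Automorphic (IsAlgebraicSubgroup IsZConnected identityComponent isZConnected_identityComponent
  lieAlgebraGL lieSubalgebraGL)
open Literature.Algebra.Lie

/-- A Lie algebra of dimension `≤ 1` over a field is abelian (`⁅a v, b v⁆ = ab ⁅v, v⁆ = 0`). [folklore] -/
private theorem isLieAbelian_of_finrank_le_one {K L : Type*} [Field K] [LieRing L] [LieAlgebra K L] [Module.Finite K L]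
    (h : Module.finrank K L ≤ 1) : IsLieAbelian L := by
  obtain ⟨v, hv⟩ := finrank_le_one_iff.1 h
  refine ⟨fun x y ↦ ?_⟩
  obtain ⟨a, rfl⟩ := hv x
  obtain ⟨b, rfl⟩ := hv y
  rw [smul_lie, lie_smul, lie_self, smul_zero, smul_zero]

/-! ### §1 A torus with `dim Hg(X) ≤ 1`: `Hg(X)(ℂ)` is almost simple and commutative -/

section Factor

variable {ι : Type*} [Fintype ι] [DecidableEq ι] {E : Type*} [NormedAddCommGroup E] [NormedSpace ℂ E]
  (Φ : (ι → ℝ) ≃L[ℝ] E)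

/-- **`dim Hg(X) ≤ 1 ⟹ Hg(X)(ℂ)` is ALMOST SIMPLE** (the written-out predicate of `ComplexTorusHodgeGroupProductDimensionSplitting`
§3: every Zariski-connected `M ≤ Hg(X)(ℂ)` — normalised or not — is `1` or `Hg(X)(ℂ)`). [cite: Springer1998, 1.8.2 and 2.2.1] -/
theorem almostSimple_map_toGL_hodgeGroupC_of_zdim_le_one (h : (isZConnected_map_toGL_hodgeGroupC Φ).zdim ≤ 1) :
    ∀ M : Subgroup (GL ι ℂ), IsZConnected M → M ≤ (hodgeGroupC Φ).map Matrix.SpecialLinearGroup.toGL →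
      (∀ g ∈ (hodgeGroupC Φ).map Matrix.SpecialLinearGroup.toGL, M.map (MulAut.conj g : GL ι ℂ →* GL ι ℂ) = M) →
        M = ⊥ ∨ M = (hodgeGroupC Φ).map Matrix.SpecialLinearGroup.toGL :=
  fun _ hM hMG _ ↦ (isZConnected_map_toGL_hodgeGroupC Φ).eq_bot_or_eq_of_zdim_le_one h hM hMG

/-- **`dim Hg(X) ≤ 1 ⟹ Lie Hg(X)(ℂ)` is abelian** (`dim_ℂ Lie Hg(X)(ℂ) = dim Hg(X) ≤ 1`, Springer 4.4.6).
[cite: Springer1998, 4.4.5–4.4.7] [cite: Humphreys1972, §1.4 (p0025)] -/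
theorem isLieAbelian_lieSubalgebraGL_hodgeGroupC_of_zdim_le_one (h : (isZConnected_map_toGL_hodgeGroupC Φ).zdim ≤ 1) :
    IsLieAbelian (lieSubalgebraGL ((hodgeGroupC Φ).map Matrix.SpecialLinearGroup.toGL)) := by
  have hGc := isZConnected_map_toGL_hodgeGroupC Φ
  haveI : Module.Finite ℂ (lieSubalgebraGL ((hodgeGroupC Φ).map Matrix.SpecialLinearGroup.toGL)) :=
    hGc.finrank_lieAlgebraGL_eq.1
  have e : Module.finrank ℂ (lieSubalgebraGL ((hodgeGroupC Φ).map Matrix.SpecialLinearGroup.toGL)) = hGc.zdim :=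
    hGc.finrank_lieAlgebraGL_eq.2
  exact isLieAbelian_of_finrank_le_one (K := ℂ) (e.trans_le h)

/-- `dim Hg(X) ≤ 1 ⟹ Lie Hg(X)(ℂ)` is solvable. [cite: Springer1998, 4.4.5–4.4.7] [cite: Humphreys1972, §1.4 (p0025)] -/
theorem isSolvable_lieSubalgebraGL_hodgeGroupC_of_zdim_le_one (h : (isZConnected_map_toGL_hodgeGroupC Φ).zdim ≤ 1) :
    LieAlgebra.IsSolvable (lieSubalgebraGL ((hodgeGroupC Φ).map Matrix.SpecialLinearGroup.toGL)) := by
  haveI := isLieAbelian_lieSubalgebraGL_hodgeGroupC_of_zdim_le_one Φ h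
  infer_instance

/-- **`dim Hg(X) ≤ 1 ⟹ Hg(X)` (real points) IS COMMUTATIVE** (abelian Lie algebra ⟺ commutative connected group,
`ComplexTorusHodgeGroupDeterminedByLieAlgebra`). [cite: Springer1998, 4.4.5–4.4.7 and 2.2.1]
[cite: MoonenZarhin1999LowDim, §3 Lemma (3.6) ("In particular `X₂` is of CM-type")] -/
theorem hodgeGroup_comm_of_zdim_le_one (h : (isZConnected_map_toGL_hodgeGroupC Φ).zdim ≤ 1) :
    ∀ M ∈ hodgeGroup Φ, ∀ N ∈ hodgeGroup Φ, M * N = N * M :=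
  (isLieAbelian_lieSubalgebraGL_hodgeGroupC_iff_hodgeGroup_comm Φ).1
    (isLieAbelian_lieSubalgebraGL_hodgeGroupC_of_zdim_le_one Φ h)

/-- `dim Hg(X) ≤ 1 ⟹ Hg(X)(ℂ)` is commutative. [cite: Springer1998, 4.4.5–4.4.7 and 2.2.1] [cite: MoonenZarhin1999LowDim, §3 Lemma (3.6)] -/
theorem hodgeGroupC_comm_of_zdim_le_one (h : (isZConnected_map_toGL_hodgeGroupC Φ).zdim ≤ 1) :
    ∀ M ∈ hodgeGroupC Φ, ∀ N ∈ hodgeGroupC Φ, M * N = N * M :=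
  (isLieAbelian_lieSubalgebraGL_hodgeGroupC_iff_hodgeGroupC_comm Φ).1
    (isLieAbelian_lieSubalgebraGL_hodgeGroupC_of_zdim_le_one Φ h)

/-- Analytic form: `dim Hg(X) ≤ 1 ⟹ 𝔥𝔤_ℂ(X) = hodgeGroupComplexLie X` is abelian. [cite: Springer1998, 4.4.5–4.4.7]
[cite: Humphreys1972, §1.4 (p0025)] -/
theorem isLieAbelian_hodgeGroupComplexLie_of_zdim_le_one (h : (isZConnected_map_toGL_hodgeGroupC Φ).zdim ≤ 1) :
    IsLieAbelian (hodgeGroupComplexLie Φ) := by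
  rw [hodgeGroupComplexLie_eq_lieSubalgebraGL Φ]
  exact isLieAbelian_lieSubalgebraGL_hodgeGroupC_of_zdim_le_one Φ h

/-- Analytic form: `dim Hg(X) ≤ 1 ⟹ 𝔥𝔤_ℂ(X)` is solvable. [cite: Springer1998, 4.4.5–4.4.7] [cite: Humphreys1972, §1.4 (p0025)] -/
theorem isSolvable_hodgeGroupComplexLie_of_zdim_le_one (h : (isZConnected_map_toGL_hodgeGroupC Φ).zdim ≤ 1) :
    LieAlgebra.IsSolvable (hodgeGroupComplexLie Φ) := by
  haveI := isLieAbelian_hodgeGroupComplexLie_of_zdim_le_one Φ h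
  infer_instance

end Factor

variable {ι₁ ι₂ : Type*} [Fintype ι₁] [Fintype ι₂] [DecidableEq ι₁] [DecidableEq ι₂]
  {E₁ E₂ : Type*} [NormedAddCommGroup E₁] [NormedSpace ℂ E₁] [NormedAddCommGroup E₂] [NormedSpace ℂ E₂]
  (Φ₁ : (ι₁ → ℝ) ≃L[ℝ] E₁) (Φ₂ : (ι₂ → ℝ) ≃L[ℝ] E₂)

/-! ### §2 Products with `dim Hg(X₂) = 1`: split or `K₂` finite -/

/-- **`dim Hg(X₂) = 1 ⟹ Hg(X₁ × X₂)(ℂ) = Hg(X₁)(ℂ) × Hg(X₂)(ℂ)` OR `K₂` IS FINITE** (`K₂° ≤ Hg(X₂)(ℂ)` is Zariski-connected,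
so `K₂° = 1` or `K₂ = Hg(X₂)(ℂ)`; Moonen–Zarhin: `Hg(X₂)` `ℚ`-simple torus ⟹ "`𝔥𝔤(X) = 𝔤₁ ⊕ 𝔤₃ ≅ 𝔥𝔤(X₁)`" unless split).
[cite: MoonenZarhin1999LowDim, §3 Lemma (3.6) (p0007 L16–L28)] [cite: Gordon1997, §2.16 Proposition] [cite: Springer1998, 1.8.2 and 2.2.1] -/
theorem hodgeGroupC_prod_eq_blockDiagProd_or_finite_hodgeGroupCProdInr_of_zdim_eq_one
    (h : (isZConnected_map_toGL_hodgeGroupC Φ₂).zdim = 1) :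
    hodgeGroupC (prodPeriod Φ₁ Φ₂) = blockDiagProd (hodgeGroupC Φ₁) (hodgeGroupC Φ₂) ∨
      ((hodgeGroupCProdInr Φ₁ Φ₂ : Subgroup (SpecialLinearGroup ι₂ ℂ)) : Set (SpecialLinearGroup ι₂ ℂ)).Finite := by
  rcases identityComponent_hodgeGroupCProdInr_eq_bot_or_eq_of_almostSimple Φ₁ Φ₂
      (almostSimple_map_toGL_hodgeGroupC_of_zdim_le_one Φ₂ h.le) with h0 | h0
  · exact Or.inr (finite_hodgeGroupCProdInr_of_identityComponent_eq_bot Φ₁ Φ₂ h0)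
  · exact Or.inl (hodgeGroupC_prod_eq_blockDiagProd_of_hodgeGroupCProdInr_eq Φ₁ Φ₂ h0)

/-- Mirror: `dim Hg(X₁) = 1 ⟹` split or `K₁` finite. [cite: MoonenZarhin1999LowDim, §3 Lemma (3.6) (p0007 L16–L28)]
[cite: Gordon1997, §2.16 Proposition] [cite: Springer1998, 1.8.2 and 2.2.1] -/
theorem hodgeGroupC_prod_eq_blockDiagProd_or_finite_hodgeGroupCProdInl_of_zdim_eq_one
    (h : (isZConnected_map_toGL_hodgeGroupC Φ₁).zdim = 1) :
    hodgeGroupC (prodPeriod Φ₁ Φ₂) = blockDiagProd (hodgeGroupC Φ₁) (hodgeGroupC Φ₂) ∨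
      ((hodgeGroupCProdInl Φ₁ Φ₂ : Subgroup (SpecialLinearGroup ι₁ ℂ)) : Set (SpecialLinearGroup ι₁ ℂ)).Finite := by
  rcases identityComponent_hodgeGroupCProdInl_eq_bot_or_eq_of_almostSimple Φ₁ Φ₂
      (almostSimple_map_toGL_hodgeGroupC_of_zdim_le_one Φ₁ h.le) with h0 | h0
  · exact Or.inr (finite_hodgeGroupCProdInl_of_identityComponent_eq_bot Φ₁ Φ₂ h0)
  · exact Or.inl (hodgeGroupC_prod_eq_blockDiagProd_of_hodgeGroupCProdInl_eq Φ₁ Φ₂ h0)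

/-- **`dim Hg(X₂) = 1 ⟹ dim Hg(X₁ × X₂) = dim Hg(X₁) + 1` (split) or `dim Hg(X₁ × X₂) = dim Hg(X₁)` (`K₂` finite).**
[cite: MoonenZarhin1999LowDim, §3 (3.1) and Lemma (3.6)] [cite: Springer1998, 5.3.2 and 1.8.2] -/
theorem zdim_prod_eq_add_one_or_eq_of_zdim_eq_one (h : (isZConnected_map_toGL_hodgeGroupC Φ₂).zdim = 1) :
    (isZConnected_map_toGL_hodgeGroupC (prodPeriod Φ₁ Φ₂)).zdim = (isZConnected_map_toGL_hodgeGroupC Φ₁).zdim + 1 ∨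
      (isZConnected_map_toGL_hodgeGroupC (prodPeriod Φ₁ Φ₂)).zdim = (isZConnected_map_toGL_hodgeGroupC Φ₁).zdim := by
  rcases hodgeGroupC_prod_eq_blockDiagProd_or_finite_hodgeGroupCProdInr_of_zdim_eq_one Φ₁ Φ₂ h with hs | hf
  · left
    rw [(hodgeGroupC_prod_eq_blockDiagProd_iff_zdim_eq_add Φ₁ Φ₂).1 hs, h]
  · exact Or.inr ((finite_hodgeGroupCProdInr_iff_zdim_prod_eq Φ₁ Φ₂).1 hf)

/-- `dim Hg(X₂) = 1`: split ⟺ `dim Hg(X₁ × X₂) = dim Hg(X₁) + 1`. [cite: MoonenZarhin1999LowDim, §3 (3.1) (1)] [cite: Springer1998, 1.8.2] -/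
theorem hodgeGroupC_prod_eq_blockDiagProd_iff_zdim_prod_eq_add_one_of_zdim_eq_one
    (h : (isZConnected_map_toGL_hodgeGroupC Φ₂).zdim = 1) :
    hodgeGroupC (prodPeriod Φ₁ Φ₂) = blockDiagProd (hodgeGroupC Φ₁) (hodgeGroupC Φ₂) ↔
      (isZConnected_map_toGL_hodgeGroupC (prodPeriod Φ₁ Φ₂)).zdim = (isZConnected_map_toGL_hodgeGroupC Φ₁).zdim + 1 := by
  rw [hodgeGroupC_prod_eq_blockDiagProd_iff_zdim_eq_add, h]

/-- A split product with `dim Hg(X₂) ≠ 0` has infinite `K₂` (`K₂ = Hg(X₂)(ℂ)` has positive dimension).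
[cite: MoonenZarhin1999LowDim, §3 (3.1)] [cite: Springer1998, 1.8.2] -/
theorem not_finite_hodgeGroupCProdInr_of_prod_eq_of_zdim_ne_zero
    (hs : hodgeGroupC (prodPeriod Φ₁ Φ₂) = blockDiagProd (hodgeGroupC Φ₁) (hodgeGroupC Φ₂))
    (h₂ : (isZConnected_map_toGL_hodgeGroupC Φ₂).zdim ≠ 0) :
    ¬ ((hodgeGroupCProdInr Φ₁ Φ₂ : Subgroup (SpecialLinearGroup ι₂ ℂ)) : Set (SpecialLinearGroup ι₂ ℂ)).Finite := by
  intro hfin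
  rw [finite_hodgeGroupCProdInr_iff_zdim_prod_eq, (hodgeGroupC_prod_eq_blockDiagProd_iff_zdim_eq_add Φ₁ Φ₂).1 hs,
    Nat.add_eq_left] at hfin
  exact h₂ hfin

/-- **`dim Hg(X₂) = 1`: `Hg(X₁ × X₂) ≠ Hg(X₁) × Hg(X₂) ⟺ K₂` IS FINITE.** [cite: MoonenZarhin1999LowDim, §3 Lemma (3.6) (p0007 L16–L28)]
[cite: Gordon1997, §2.16 Proposition] [cite: Springer1998, 1.8.2 and 2.2.1] -/
theorem hodgeGroupC_prod_ne_blockDiagProd_iff_finite_hodgeGroupCProdInr_of_zdim_eq_one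
    (h : (isZConnected_map_toGL_hodgeGroupC Φ₂).zdim = 1) :
    hodgeGroupC (prodPeriod Φ₁ Φ₂) ≠ blockDiagProd (hodgeGroupC Φ₁) (hodgeGroupC Φ₂) ↔
      ((hodgeGroupCProdInr Φ₁ Φ₂ : Subgroup (SpecialLinearGroup ι₂ ℂ)) : Set (SpecialLinearGroup ι₂ ℂ)).Finite :=
  ⟨fun hne ↦ (hodgeGroupC_prod_eq_blockDiagProd_or_finite_hodgeGroupCProdInr_of_zdim_eq_one Φ₁ Φ₂ h).resolve_left hne,
    fun hfin hs ↦ not_finite_hodgeGroupCProdInr_of_prod_eq_of_zdim_ne_zero Φ₁ Φ₂ hs (by omega) hfin⟩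

/-- `dim Hg(X₂) = 1`: non-split ⟺ `dim Hg(X₁ × X₂) = dim Hg(X₁)`. [cite: MoonenZarhin1999LowDim, §3 (3.1) and Lemma (3.6)]
[cite: Springer1998, 5.3.2 and 1.8.2] -/
theorem hodgeGroupC_prod_ne_blockDiagProd_iff_zdim_prod_eq_of_zdim_eq_one
    (h : (isZConnected_map_toGL_hodgeGroupC Φ₂).zdim = 1) :
    hodgeGroupC (prodPeriod Φ₁ Φ₂) ≠ blockDiagProd (hodgeGroupC Φ₁) (hodgeGroupC Φ₂) ↔
      (isZConnected_map_toGL_hodgeGroupC (prodPeriod Φ₁ Φ₂)).zdim = (isZConnected_map_toGL_hodgeGroupC Φ₁).zdim := by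
  rw [hodgeGroupC_prod_ne_blockDiagProd_iff_finite_hodgeGroupCProdInr_of_zdim_eq_one Φ₁ Φ₂ h,
    finite_hodgeGroupCProdInr_iff_zdim_prod_eq]

/-- Mirror: `dim Hg(X₁) = 1`: non-split ⟺ `K₁` finite. [cite: MoonenZarhin1999LowDim, §3 Lemma (3.6) (p0007 L16–L28)]
[cite: Gordon1997, §2.16 Proposition] [cite: Springer1998, 1.8.2 and 2.2.1] -/
theorem hodgeGroupC_prod_ne_blockDiagProd_iff_finite_hodgeGroupCProdInl_of_zdim_eq_one
    (h : (isZConnected_map_toGL_hodgeGroupC Φ₁).zdim = 1) :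
    hodgeGroupC (prodPeriod Φ₁ Φ₂) ≠ blockDiagProd (hodgeGroupC Φ₁) (hodgeGroupC Φ₂) ↔
      ((hodgeGroupCProdInl Φ₁ Φ₂ : Subgroup (SpecialLinearGroup ι₁ ℂ)) : Set (SpecialLinearGroup ι₁ ℂ)).Finite :=
  ⟨fun hne ↦ (hodgeGroupC_prod_eq_blockDiagProd_or_finite_hodgeGroupCProdInl_of_zdim_eq_one Φ₁ Φ₂ h).resolve_left hne,
    fun hfin hs ↦ not_finite_hodgeGroupCProdInl_of_prod_eq_of_zdim_ne_zero Φ₁ Φ₂ hs (by omega) hfin⟩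

/-- Mirror: `dim Hg(X₁) = 1`: non-split ⟺ `dim Hg(X₁ × X₂) = dim Hg(X₂)`. [cite: MoonenZarhin1999LowDim, §3 (3.1) and Lemma (3.6)]
[cite: Springer1998, 5.3.2 and 1.8.2] -/
theorem hodgeGroupC_prod_ne_blockDiagProd_iff_zdim_prod_eq_right_of_zdim_eq_one
    (h : (isZConnected_map_toGL_hodgeGroupC Φ₁).zdim = 1) :
    hodgeGroupC (prodPeriod Φ₁ Φ₂) ≠ blockDiagProd (hodgeGroupC Φ₁) (hodgeGroupC Φ₂) ↔
      (isZConnected_map_toGL_hodgeGroupC (prodPeriod Φ₁ Φ₂)).zdim = (isZConnected_map_toGL_hodgeGroupC Φ₂).zdim := by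
  rw [hodgeGroupC_prod_ne_blockDiagProd_iff_finite_hodgeGroupCProdInl_of_zdim_eq_one Φ₁ Φ₂ h,
    finite_hodgeGroupCProdInl_iff_zdim_prod_eq]

/-- **Two one-dimensional Hodge groups (e.g. two CM elliptic curves): `dim Hg(X₁ × X₂) ∈ {1, 2}`.**
[cite: MoonenZarhin1999LowDim, §3 (3.1)] [cite: Springer1998, 5.3.2 and 1.8.2] -/
theorem zdim_prod_eq_one_or_eq_two_of_zdim_eq_one (h₁ : (isZConnected_map_toGL_hodgeGroupC Φ₁).zdim = 1)
    (h₂ : (isZConnected_map_toGL_hodgeGroupC Φ₂).zdim = 1) :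
    (isZConnected_map_toGL_hodgeGroupC (prodPeriod Φ₁ Φ₂)).zdim = 1 ∨
      (isZConnected_map_toGL_hodgeGroupC (prodPeriod Φ₁ Φ₂)).zdim = 2 := by
  rcases zdim_prod_eq_add_one_or_eq_of_zdim_eq_one Φ₁ Φ₂ h₂ with h | h <;> omega

/-- Two one-dimensional Hodge groups: split ⟺ `dim Hg(X₁ × X₂) = 2`, non-split ⟺ `dim Hg(X₁ × X₂) = 1` ⟺ both `K₁` and `K₂`
are finite (the graph ∕ isogeny-type case). [cite: MoonenZarhin1999LowDim, §3 (3.1)] [cite: Gordon1997, §2.16 Proposition] -/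
theorem hodgeGroupC_prod_eq_blockDiagProd_iff_zdim_prod_eq_two_of_zdim_eq_one
    (h₁ : (isZConnected_map_toGL_hodgeGroupC Φ₁).zdim = 1) (h₂ : (isZConnected_map_toGL_hodgeGroupC Φ₂).zdim = 1) :
    (hodgeGroupC (prodPeriod Φ₁ Φ₂) = blockDiagProd (hodgeGroupC Φ₁) (hodgeGroupC Φ₂) ↔
      (isZConnected_map_toGL_hodgeGroupC (prodPeriod Φ₁ Φ₂)).zdim = 2) ∧
    (hodgeGroupC (prodPeriod Φ₁ Φ₂) ≠ blockDiagProd (hodgeGroupC Φ₁) (hodgeGroupC Φ₂) ↔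
      (isZConnected_map_toGL_hodgeGroupC (prodPeriod Φ₁ Φ₂)).zdim = 1) ∧
    (hodgeGroupC (prodPeriod Φ₁ Φ₂) ≠ blockDiagProd (hodgeGroupC Φ₁) (hodgeGroupC Φ₂) ↔
      ((hodgeGroupCProdInl Φ₁ Φ₂ : Subgroup (SpecialLinearGroup ι₁ ℂ)) : Set (SpecialLinearGroup ι₁ ℂ)).Finite ∧
        ((hodgeGroupCProdInr Φ₁ Φ₂ : Subgroup (SpecialLinearGroup ι₂ ℂ)) : Set (SpecialLinearGroup ι₂ ℂ)).Finite) := by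
  refine ⟨?_, ?_, ?_⟩
  · rw [hodgeGroupC_prod_eq_blockDiagProd_iff_zdim_eq_add, h₁, h₂]
  · rw [hodgeGroupC_prod_ne_blockDiagProd_iff_zdim_prod_eq_of_zdim_eq_one Φ₁ Φ₂ h₂, h₁]
  · rw [hodgeGroupC_prod_ne_blockDiagProd_iff_finite_hodgeGroupCProdInr_of_zdim_eq_one Φ₁ Φ₂ h₂]
    refine ⟨fun h ↦ ⟨?_, h⟩, fun h ↦ h.2⟩
    rwa [finite_hodgeGroupCProdInl_iff_finite_hodgeGroupCProdInr_of_zdim_eq Φ₁ Φ₂ (h₁.trans h₂.symm)]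

/-! ### §3 Splitting criteria with `dim Hg(X₂) ≤ 1` (`Lie Hg(X₂)(ℂ)` abelian) -/

/-- **`Lie Hg(X₁)(ℂ)` PERFECT and `dim Hg(X₂) ≤ 1 ⟹ Hg(X₁ × X₂)(ℂ) = Hg(X₁)(ℂ) × Hg(X₂)(ℂ)`** (perfect × solvable splits,
g41-#2; Moonen–Zarhin Thm. (3.2) (2) "no type IV × CM", here with an arbitrary torus `X₁`). [cite: MoonenZarhin1999LowDim, §3 Theorem (3.2) (2) and Lemma (3.6)]
[cite: Gordon1997, §3 Theorem, proof (p0014 L33–L37)] -/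
theorem hodgeGroupC_prod_eq_blockDiagProd_of_derivedSeries_eq_top_of_zdim_le_one
    (h₁ : LieAlgebra.derivedSeries ℂ (lieSubalgebraGL ((hodgeGroupC Φ₁).map Matrix.SpecialLinearGroup.toGL)) 1 = ⊤)
    (h : (isZConnected_map_toGL_hodgeGroupC Φ₂).zdim ≤ 1) :
    hodgeGroupC (prodPeriod Φ₁ Φ₂) = blockDiagProd (hodgeGroupC Φ₁) (hodgeGroupC Φ₂) := by
  haveI := isSolvable_lieSubalgebraGL_hodgeGroupC_of_zdim_le_one Φ₂ h
  exact hodgeGroupC_prod_eq_blockDiagProd_of_derivedSeries_eq_top_of_isSolvable Φ₁ Φ₂ h₁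

/-- `Lie Hg(X₁)(ℂ)` semisimple and `dim Hg(X₂) ≤ 1 ⟹` split. [cite: MoonenZarhin1999LowDim, §3 Theorem (3.2) (2) and Lemma (3.6)]
[cite: Gordon1997, §3 Theorem, proof (p0014 L33–L37)] -/
theorem hodgeGroupC_prod_eq_blockDiagProd_of_isSemisimple_of_zdim_le_one
    [LieAlgebra.IsSemisimple ℂ (lieSubalgebraGL ((hodgeGroupC Φ₁).map Matrix.SpecialLinearGroup.toGL))]
    (h : (isZConnected_map_toGL_hodgeGroupC Φ₂).zdim ≤ 1) :
    hodgeGroupC (prodPeriod Φ₁ Φ₂) = blockDiagProd (hodgeGroupC Φ₁) (hodgeGroupC Φ₂) := by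
  haveI := isSolvable_lieSubalgebraGL_hodgeGroupC_of_zdim_le_one Φ₂ h
  exact hodgeGroupC_prod_eq_blockDiagProd_of_isSemisimple_of_isSolvable Φ₁ Φ₂

/-- **Polarised `X₁` with `𝔷(𝔥𝔤_ℂ X₁) = 0` and `dim Hg(X₂) ≤ 1 ⟹` split** (Moonen–Zarhin (3.6) contrapositive: a non-split
product forces a non-trivial centre). [cite: MoonenZarhin1999LowDim, §3 Lemma (3.6) (p0007 L16–L28)] -/
theorem IsRiemannForm.hodgeGroupC_prod_eq_blockDiagProd_of_center_eq_bot_of_zdim_le_one {η₁ : E₁ [⋀^Fin 2]→L[ℝ] ℝ}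
    (hη₁ : IsRiemannForm Φ₁ η₁) (h0 : LieAlgebra.center ℂ (hodgeGroupComplexLie Φ₁) = ⊥)
    (h : (isZConnected_map_toGL_hodgeGroupC Φ₂).zdim ≤ 1) :
    hodgeGroupC (prodPeriod Φ₁ Φ₂) = blockDiagProd (hodgeGroupC Φ₁) (hodgeGroupC Φ₂) := by
  haveI := isSolvable_hodgeGroupComplexLie_of_zdim_le_one Φ₂ h
  exact hη₁.hodgeGroupC_prod_eq_blockDiagProd_of_center_eq_bot_of_isSolvable Φ₁ Φ₂ h0

/-- Real points: `Lie Hg(X₁)(ℂ)` perfect and `dim Hg(X₂) ≤ 1 ⟹ Hg(X₁ × X₂) = Hg(X₁) × Hg(X₂)`.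
[cite: MoonenZarhin1999LowDim, §3 Theorem (3.2) (2) and Lemma (3.6)] -/
theorem hodgeGroup_prod_eq_of_derivedSeries_eq_top_of_zdim_le_one
    (h₁ : LieAlgebra.derivedSeries ℂ (lieSubalgebraGL ((hodgeGroupC Φ₁).map Matrix.SpecialLinearGroup.toGL)) 1 = ⊤)
    (h : (isZConnected_map_toGL_hodgeGroupC Φ₂).zdim ≤ 1) :
    hodgeGroup (prodPeriod Φ₁ Φ₂) = ((hodgeGroup Φ₁).prod (hodgeGroup Φ₂)).map (blockDiag ι₁ ι₂) := by
  haveI := isSolvable_lieSubalgebraGL_hodgeGroupC_of_zdim_le_one Φ₂ h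
  exact hodgeGroup_prod_eq_of_derivedSeries_eq_top_of_isSolvable Φ₁ Φ₂ h₁

/-- (D)-transfer: `Lie Hg(X₁)(ℂ)` perfect, `dim Hg(X₂) ≤ 1`, and (D) for the powers of `X₁` and of `X₂ ⟹` (D) for the powers of
`X₁ × X₂`. [cite: MoonenZarhin1999LowDim, §3 Theorem (3.2) (2)] [cite: Gordon1997, §3 Theorem] -/
theorem forall_divisorClasses_powPeriod_prod_eq_hodgeClasses_of_derivedSeries_eq_top_of_zdim_le_one
    (h₁ : LieAlgebra.derivedSeries ℂ (lieSubalgebraGL ((hodgeGroupC Φ₁).map Matrix.SpecialLinearGroup.toGL)) 1 = ⊤)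
    (h : (isZConnected_map_toGL_hodgeGroupC Φ₂).zdim ≤ 1)
    (hX₁ : ∀ k p, divisorClasses (powPeriod Φ₁ k) p = hodgeClasses (powPeriod Φ₁ k) p)
    (hX₂ : ∀ k p, divisorClasses (powPeriod Φ₂ k) p = hodgeClasses (powPeriod Φ₂ k) p) :
    ∀ k p, divisorClasses (powPeriod (prodPeriod Φ₁ Φ₂) k) p = hodgeClasses (powPeriod (prodPeriod Φ₁ Φ₂) k) p := by
  haveI := isSolvable_lieSubalgebraGL_hodgeGroupC_of_zdim_le_one Φ₂ h
  exact forall_divisorClasses_powPeriod_prod_eq_hodgeClasses_of_derivedSeries_eq_top_of_isSolvable h₁ hX₁ hX₂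

/-- Contrapositive: `dim Hg(X₂) ≤ 1` and non-split ⟹ `Lie Hg(X₁)(ℂ)` is NOT perfect. [cite: MoonenZarhin1999LowDim, §3 Lemma (3.6) (p0007 L16–L28)]
[cite: Gordon1997, §3 Theorem, proof (p0014 L33–L37)] -/
theorem derivedSeries_lieSubalgebraGL_ne_top_of_ne_of_zdim_le_one (h : (isZConnected_map_toGL_hodgeGroupC Φ₂).zdim ≤ 1)
    (hne : hodgeGroupC (prodPeriod Φ₁ Φ₂) ≠ blockDiagProd (hodgeGroupC Φ₁) (hodgeGroupC Φ₂)) :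
    LieAlgebra.derivedSeries ℂ (lieSubalgebraGL ((hodgeGroupC Φ₁).map Matrix.SpecialLinearGroup.toGL)) 1 ≠ ⊤ := fun h₁ ↦
  hne (hodgeGroupC_prod_eq_blockDiagProd_of_derivedSeries_eq_top_of_zdim_le_one Φ₁ Φ₂ h₁ h)

/-- Contrapositive, polarised `X₁`: `dim Hg(X₂) ≤ 1` and non-split ⟹ `𝔷(𝔥𝔤_ℂ X₁) ≠ 0`. [cite: MoonenZarhin1999LowDim, §3 Lemma (3.6) (p0007 L16–L28)] -/
theorem IsRiemannForm.center_hodgeGroupComplexLie_ne_bot_of_ne_of_zdim_le_one {η₁ : E₁ [⋀^Fin 2]→L[ℝ] ℝ}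
    (hη₁ : IsRiemannForm Φ₁ η₁) (h : (isZConnected_map_toGL_hodgeGroupC Φ₂).zdim ≤ 1)
    (hne : hodgeGroupC (prodPeriod Φ₁ Φ₂) ≠ blockDiagProd (hodgeGroupC Φ₁) (hodgeGroupC Φ₂)) :
    LieAlgebra.center ℂ (hodgeGroupComplexLie Φ₁) ≠ ⊥ := fun h0 ↦
  hne (hη₁.hodgeGroupC_prod_eq_blockDiagProd_of_center_eq_bot_of_zdim_le_one Φ₁ Φ₂ h0 h)

/-! ### §4 The centre of `Lie Hg(X₁)(ℂ)` surjects onto `Lie Hg(X₂)(ℂ)` when `K₂` is finite (Moonen–Zarhin (3.6)) -/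

/-- **MOONEN–ZARHIN (3.6), COMPLEX LIE FORM: `Lie Hg(X₁)(ℂ)` REDUCTIVE, `Lie Hg(X₂)(ℂ)` SOLVABLE, `K₂` FINITE ⟹ THE CENTRE
`𝔷(Lie Hg(X₁)(ℂ))` SURJECTS ONTO `Lie Hg(X₂)(ℂ)`** ("the center of `Hg(X₁)` contains an algebraic torus which is
`ℚ`-isogenous to `Hg(X₂)`"): `K₂` finite makes the block projection `r₁ : Lie G → Lie G₁` an isomorphism (g41-#5), so
`φ = r₂ ∘ r₁⁻¹ : Lie G₁ ↠ Lie G₂` has kernel the Goursat ideal `𝔫₁`, and `𝔷(Lie G₁) + 𝔫₁ = Lie G₁` for reductive `Lie G₁` and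
solvable `Lie G₂` (g41-#1 `center_sup_map_ker_eq_top_of_hasCentralRadical_of_isSolvable`, Humphreys 19.1 (a)).
[cite: MoonenZarhin1999LowDim, §3 Lemma (3.6) (p0007 L16–L28)] [cite: Humphreys1972, §19.1 Proposition (a)] [cite: Gordon1997, §2.16 Proposition] -/
theorem exists_surjective_lieHom_center_of_finite_hodgeGroupCProdInr
    [LieAlgebra.HasCentralRadical ℂ (lieSubalgebraGL ((hodgeGroupC Φ₁).map Matrix.SpecialLinearGroup.toGL))]
    [LieAlgebra.IsSolvable (lieSubalgebraGL ((hodgeGroupC Φ₂).map Matrix.SpecialLinearGroup.toGL))]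
    (hK : ((hodgeGroupCProdInr Φ₁ Φ₂ : Subgroup (SpecialLinearGroup ι₂ ℂ)) : Set (SpecialLinearGroup ι₂ ℂ)).Finite) :
    ∃ ψ : LieAlgebra.center ℂ (lieSubalgebraGL ((hodgeGroupC Φ₁).map Matrix.SpecialLinearGroup.toGL)) →ₗ⁅ℂ⁆
        lieSubalgebraGL ((hodgeGroupC Φ₂).map Matrix.SpecialLinearGroup.toGL), Function.Surjective ψ := by
  have hGc := isZConnected_map_toGL_hodgeGroupC (prodPeriod Φ₁ Φ₂)
  have hG₁c := isZConnected_map_toGL_hodgeGroupC Φ₁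
  haveI : Module.Finite ℂ (lieSubalgebraGL ((hodgeGroupC (prodPeriod Φ₁ Φ₂)).map Matrix.SpecialLinearGroup.toGL)) :=
    hGc.finrank_lieAlgebraGL_eq.1
  haveI : Module.Finite ℂ (lieSubalgebraGL ((hodgeGroupC Φ₁).map Matrix.SpecialLinearGroup.toGL)) :=
    hG₁c.finrank_lieAlgebraGL_eq.1
  have e₀ : Module.finrank ℂ (lieSubalgebraGL ((hodgeGroupC (prodPeriod Φ₁ Φ₂)).map Matrix.SpecialLinearGroup.toGL)) =
      hGc.zdim := hGc.finrank_lieAlgebraGL_eq.2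
  have e₁ : Module.finrank ℂ (lieSubalgebraGL ((hodgeGroupC Φ₁).map Matrix.SpecialLinearGroup.toGL)) = hG₁c.zdim :=
    hG₁c.finrank_lieAlgebraGL_eq.2
  have hz := (finite_hodgeGroupCProdInr_iff_zdim_prod_eq Φ₁ Φ₂).1 hK
  obtain ⟨f, g, -, -, hfs, hgs, -⟩ := exists_lieHom_toBlocks Φ₁ Φ₂
  have hinj : Function.Injective f :=
    (LinearMap.injective_iff_surjective_of_finrank_eq_finrank (by rw [e₀, e₁, hz])
      (f := (f : lieSubalgebraGL ((hodgeGroupC (prodPeriod Φ₁ Φ₂)).map Matrix.SpecialLinearGroup.toGL) →ₗ[ℂ]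
        lieSubalgebraGL ((hodgeGroupC Φ₁).map Matrix.SpecialLinearGroup.toGL)))).2 hfs
  let e := LieEquiv.ofBijective f ⟨hinj, hfs⟩
  let φ : lieSubalgebraGL ((hodgeGroupC Φ₁).map Matrix.SpecialLinearGroup.toGL) →ₗ⁅ℂ⁆
      lieSubalgebraGL ((hodgeGroupC Φ₂).map Matrix.SpecialLinearGroup.toGL) := g.comp e.symm.toLieHom
  have hφf : ∀ Z, φ (f Z) = g Z := fun Z ↦ by
    change g (e.symm (e Z)) = g Z
    rw [e.symm_apply_apply]
  have htop := GoursatPerfectSolvable.center_sup_map_ker_eq_top_of_hasCentralRadical_of_isSolvable f g hfs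
  refine ⟨φ.comp (LieAlgebra.center ℂ _).incl, fun b ↦ ?_⟩
  obtain ⟨Z, rfl⟩ := hgs b
  have hmem : f Z ∈ LieAlgebra.center ℂ (lieSubalgebraGL ((hodgeGroupC Φ₁).map Matrix.SpecialLinearGroup.toGL)) ⊔
      LieIdeal.map f g.ker := by
    rw [htop]
    exact LieSubmodule.mem_top _
  obtain ⟨z, hz', w, hw, hzw⟩ := (LieSubmodule.mem_sup _ _ _).1 hmem
  obtain ⟨W, hgW, hfW⟩ := (GoursatLemma.mem_map_ker_iff f g hfs).1 hw
  refine ⟨⟨z, hz'⟩, ?_⟩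
  change φ z = g Z
  rw [← hφf Z, ← hzw, map_add, ← hfW, hφf W, hgW, add_zero]

/-- **THE CENTRE OF `Lie Hg(X₁)(ℂ)` CONTAINS A COPY OF `Lie Hg(X₂)(ℂ)`** (same hypotheses): a linear section of the surjection
`𝔷(Lie G₁) ↠ Lie G₂` is an injective homomorphism of Lie algebras (`Lie G₂ ≅` a quotient of the abelian `𝔷`, so both brackets
vanish). [cite: MoonenZarhin1999LowDim, §3 Lemma (3.6) (p0007 L16–L28) ("the center of `Hg(X₁)` contains an algebraic torus which is `ℚ`-isogenous to `Hg(X₂)`")]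
[cite: Humphreys1972, §19.1 Proposition (a)] -/
theorem exists_injective_lieHom_center_of_finite_hodgeGroupCProdInr
    [LieAlgebra.HasCentralRadical ℂ (lieSubalgebraGL ((hodgeGroupC Φ₁).map Matrix.SpecialLinearGroup.toGL))]
    [LieAlgebra.IsSolvable (lieSubalgebraGL ((hodgeGroupC Φ₂).map Matrix.SpecialLinearGroup.toGL))]
    (hK : ((hodgeGroupCProdInr Φ₁ Φ₂ : Subgroup (SpecialLinearGroup ι₂ ℂ)) : Set (SpecialLinearGroup ι₂ ℂ)).Finite) :
    ∃ j : lieSubalgebraGL ((hodgeGroupC Φ₂).map Matrix.SpecialLinearGroup.toGL) →ₗ⁅ℂ⁆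
        LieAlgebra.center ℂ (lieSubalgebraGL ((hodgeGroupC Φ₁).map Matrix.SpecialLinearGroup.toGL)), Function.Injective j := by
  obtain ⟨ψ, hψ⟩ := exists_surjective_lieHom_center_of_finite_hodgeGroupCProdInr Φ₁ Φ₂ hK
  obtain ⟨s, hs⟩ := (ψ : LieAlgebra.center ℂ (lieSubalgebraGL ((hodgeGroupC Φ₁).map Matrix.SpecialLinearGroup.toGL)) →ₗ[ℂ]
      lieSubalgebraGL ((hodgeGroupC Φ₂).map Matrix.SpecialLinearGroup.toGL)).exists_rightInverse_of_surjective
    (LinearMap.range_eq_top.2 hψ)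
  have hs' : ∀ b, ψ (s b) = b := fun b ↦ LinearMap.congr_fun hs b
  have key : ∀ a b : LieAlgebra.center ℂ (lieSubalgebraGL ((hodgeGroupC Φ₁).map Matrix.SpecialLinearGroup.toGL)),
      ⁅a, b⁆ = 0 := fun a b ↦ trivial_lie_zero _ _ a b
  refine ⟨{ s with map_lie' := fun {x y} ↦ ?_ }, Function.LeftInverse.injective hs'⟩
  change s ⁅x, y⁆ = ⁅s x, s y⁆
  rw [key, ← hs' x, ← hs' y, ← LieHom.map_lie, key, map_zero, map_zero]

/-- `K₂` finite, `Lie Hg(X₁)(ℂ)` reductive, `Lie Hg(X₂)(ℂ)` solvable ⟹ `dim_ℂ Lie Hg(X₂)(ℂ) ≤ dim_ℂ 𝔷(Lie Hg(X₁)(ℂ))`.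
[cite: MoonenZarhin1999LowDim, §3 Lemma (3.6) (p0007 L16–L28)] -/
theorem finrank_le_finrank_center_of_finite_hodgeGroupCProdInr
    [LieAlgebra.HasCentralRadical ℂ (lieSubalgebraGL ((hodgeGroupC Φ₁).map Matrix.SpecialLinearGroup.toGL))]
    [LieAlgebra.IsSolvable (lieSubalgebraGL ((hodgeGroupC Φ₂).map Matrix.SpecialLinearGroup.toGL))]
    (hK : ((hodgeGroupCProdInr Φ₁ Φ₂ : Subgroup (SpecialLinearGroup ι₂ ℂ)) : Set (SpecialLinearGroup ι₂ ℂ)).Finite) :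
    Module.finrank ℂ (lieSubalgebraGL ((hodgeGroupC Φ₂).map Matrix.SpecialLinearGroup.toGL)) ≤
      Module.finrank ℂ (LieAlgebra.center ℂ (lieSubalgebraGL ((hodgeGroupC Φ₁).map Matrix.SpecialLinearGroup.toGL))) := by
  have hG₁c := isZConnected_map_toGL_hodgeGroupC Φ₁
  haveI : Module.Finite ℂ (lieSubalgebraGL ((hodgeGroupC Φ₁).map Matrix.SpecialLinearGroup.toGL)) :=
    hG₁c.finrank_lieAlgebraGL_eq.1
  haveI : Module.Finite ℂ (LieAlgebra.center ℂ (lieSubalgebraGL ((hodgeGroupC Φ₁).map Matrix.SpecialLinearGroup.toGL))) :=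
    Module.Finite.of_injective _ (LieIdeal.incl_injective _)
  obtain ⟨ψ, hψ⟩ := exists_surjective_lieHom_center_of_finite_hodgeGroupCProdInr Φ₁ Φ₂ hK
  exact LinearMap.finrank_le_finrank_of_surjective
    (f := (ψ : LieAlgebra.center ℂ (lieSubalgebraGL ((hodgeGroupC Φ₁).map Matrix.SpecialLinearGroup.toGL)) →ₗ[ℂ]
      lieSubalgebraGL ((hodgeGroupC Φ₂).map Matrix.SpecialLinearGroup.toGL))) hψ

/-- `zdim` form: `K₂` finite, `Lie Hg(X₁)(ℂ)` reductive, `Lie Hg(X₂)(ℂ)` solvable ⟹ `dim Hg(X₂) ≤ dim_ℂ 𝔷(Lie Hg(X₁)(ℂ))`.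
[cite: MoonenZarhin1999LowDim, §3 Lemma (3.6) (p0007 L16–L28)] [cite: Springer1998, 4.4.5–4.4.7] -/
theorem zdim_le_finrank_center_of_finite_hodgeGroupCProdInr
    [LieAlgebra.HasCentralRadical ℂ (lieSubalgebraGL ((hodgeGroupC Φ₁).map Matrix.SpecialLinearGroup.toGL))]
    [LieAlgebra.IsSolvable (lieSubalgebraGL ((hodgeGroupC Φ₂).map Matrix.SpecialLinearGroup.toGL))]
    (hK : ((hodgeGroupCProdInr Φ₁ Φ₂ : Subgroup (SpecialLinearGroup ι₂ ℂ)) : Set (SpecialLinearGroup ι₂ ℂ)).Finite) :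
    (isZConnected_map_toGL_hodgeGroupC Φ₂).zdim ≤
      Module.finrank ℂ (LieAlgebra.center ℂ (lieSubalgebraGL ((hodgeGroupC Φ₁).map Matrix.SpecialLinearGroup.toGL))) := by
  rw [← (isZConnected_map_toGL_hodgeGroupC Φ₂).finrank_lieAlgebraGL_eq.2]
  exact finrank_le_finrank_center_of_finite_hodgeGroupCProdInr Φ₁ Φ₂ hK

/-- Mirror: `K₁` finite, `Lie Hg(X₂)(ℂ)` reductive, `Lie Hg(X₁)(ℂ)` solvable ⟹ `𝔷(Lie Hg(X₂)(ℂ)) ↠ Lie Hg(X₁)(ℂ)`.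
[cite: MoonenZarhin1999LowDim, §3 Lemma (3.6) (p0007 L16–L28)] [cite: Humphreys1972, §19.1 Proposition (a)] -/
theorem exists_surjective_lieHom_center_of_finite_hodgeGroupCProdInl
    [LieAlgebra.HasCentralRadical ℂ (lieSubalgebraGL ((hodgeGroupC Φ₂).map Matrix.SpecialLinearGroup.toGL))]
    [LieAlgebra.IsSolvable (lieSubalgebraGL ((hodgeGroupC Φ₁).map Matrix.SpecialLinearGroup.toGL))]
    (hK : ((hodgeGroupCProdInl Φ₁ Φ₂ : Subgroup (SpecialLinearGroup ι₁ ℂ)) : Set (SpecialLinearGroup ι₁ ℂ)).Finite) :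
    ∃ ψ : LieAlgebra.center ℂ (lieSubalgebraGL ((hodgeGroupC Φ₂).map Matrix.SpecialLinearGroup.toGL)) →ₗ⁅ℂ⁆
        lieSubalgebraGL ((hodgeGroupC Φ₁).map Matrix.SpecialLinearGroup.toGL), Function.Surjective ψ := by
  have hGc := isZConnected_map_toGL_hodgeGroupC (prodPeriod Φ₁ Φ₂)
  have hG₂c := isZConnected_map_toGL_hodgeGroupC Φ₂
  haveI : Module.Finite ℂ (lieSubalgebraGL ((hodgeGroupC (prodPeriod Φ₁ Φ₂)).map Matrix.SpecialLinearGroup.toGL)) :=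
    hGc.finrank_lieAlgebraGL_eq.1
  haveI : Module.Finite ℂ (lieSubalgebraGL ((hodgeGroupC Φ₂).map Matrix.SpecialLinearGroup.toGL)) :=
    hG₂c.finrank_lieAlgebraGL_eq.1
  have e₀ : Module.finrank ℂ (lieSubalgebraGL ((hodgeGroupC (prodPeriod Φ₁ Φ₂)).map Matrix.SpecialLinearGroup.toGL)) =
      hGc.zdim := hGc.finrank_lieAlgebraGL_eq.2
  have e₂ : Module.finrank ℂ (lieSubalgebraGL ((hodgeGroupC Φ₂).map Matrix.SpecialLinearGroup.toGL)) = hG₂c.zdim :=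
    hG₂c.finrank_lieAlgebraGL_eq.2
  have hz := (finite_hodgeGroupCProdInl_iff_zdim_prod_eq Φ₁ Φ₂).1 hK
  obtain ⟨f, g, -, -, hfs, hgs, -⟩ := exists_lieHom_toBlocks Φ₁ Φ₂
  have hinj : Function.Injective g :=
    (LinearMap.injective_iff_surjective_of_finrank_eq_finrank (by rw [e₀, e₂, hz])
      (f := (g : lieSubalgebraGL ((hodgeGroupC (prodPeriod Φ₁ Φ₂)).map Matrix.SpecialLinearGroup.toGL) →ₗ[ℂ]
        lieSubalgebraGL ((hodgeGroupC Φ₂).map Matrix.SpecialLinearGroup.toGL)))).2 hgs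
  let e := LieEquiv.ofBijective g ⟨hinj, hgs⟩
  let φ : lieSubalgebraGL ((hodgeGroupC Φ₂).map Matrix.SpecialLinearGroup.toGL) →ₗ⁅ℂ⁆
      lieSubalgebraGL ((hodgeGroupC Φ₁).map Matrix.SpecialLinearGroup.toGL) := f.comp e.symm.toLieHom
  have hφg : ∀ Z, φ (g Z) = f Z := fun Z ↦ by
    change f (e.symm (e Z)) = f Z
    rw [e.symm_apply_apply]
  have htop := GoursatPerfectSolvable.center_sup_map_ker_eq_top_of_hasCentralRadical_of_isSolvable g f hgs
  refine ⟨φ.comp (LieAlgebra.center ℂ _).incl, fun a ↦ ?_⟩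
  obtain ⟨Z, rfl⟩ := hfs a
  have hmem : g Z ∈ LieAlgebra.center ℂ (lieSubalgebraGL ((hodgeGroupC Φ₂).map Matrix.SpecialLinearGroup.toGL)) ⊔
      LieIdeal.map g f.ker := by
    rw [htop]
    exact LieSubmodule.mem_top _
  obtain ⟨z, hz', w, hw, hzw⟩ := (LieSubmodule.mem_sup _ _ _).1 hmem
  obtain ⟨W, hfW, hgW⟩ := (GoursatLemma.mem_map_ker_iff g f hgs).1 hw
  refine ⟨⟨z, hz'⟩, ?_⟩
  change φ z = f Z
  rw [← hφg Z, ← hzw, map_add, ← hgW, hφg W, hfW, add_zero]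

/-- **Polarised form of Moonen–Zarhin (3.6)**: `X₁` polarised (`𝔥𝔤_ℂ(X₁)` is then reductive), `𝔥𝔤_ℂ(X₂)` solvable, `K₂`
finite ⟹ the centre `𝔷(𝔥𝔤_ℂ X₁)` surjects onto `𝔥𝔤_ℂ(X₂)`. [cite: MoonenZarhin1999LowDim, §3 Lemma (3.6) (p0007 L16–L28)]
[cite: Humphreys1972, §19.1 Proposition (a)] -/
theorem IsRiemannForm.exists_surjective_lieHom_center_hodgeGroupComplexLie_of_finite_hodgeGroupCProdInr
    {η₁ : E₁ [⋀^Fin 2]→L[ℝ] ℝ} (hη₁ : IsRiemannForm Φ₁ η₁) [h₂ : LieAlgebra.IsSolvable (hodgeGroupComplexLie Φ₂)]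
    (hK : ((hodgeGroupCProdInr Φ₁ Φ₂ : Subgroup (SpecialLinearGroup ι₂ ℂ)) : Set (SpecialLinearGroup ι₂ ℂ)).Finite) :
    ∃ ψ : LieAlgebra.center ℂ (hodgeGroupComplexLie Φ₁) →ₗ⁅ℂ⁆ hodgeGroupComplexLie Φ₂, Function.Surjective ψ := by
  have h₁ := hη₁.hasCentralRadical_hodgeGroupComplexLie
  rw [hodgeGroupComplexLie_eq_lieSubalgebraGL Φ₁] at h₁ ⊢
  rw [hodgeGroupComplexLie_eq_lieSubalgebraGL Φ₂] at h₂ ⊢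
  haveI := h₁
  exact exists_surjective_lieHom_center_of_finite_hodgeGroupCProdInr Φ₁ Φ₂ hK

/-- Polarised form: `𝔥𝔤_ℂ(X₂)` embeds into the centre `𝔷(𝔥𝔤_ℂ X₁)` (`X₁` polarised, `𝔥𝔤_ℂ(X₂)` solvable, `K₂` finite).
[cite: MoonenZarhin1999LowDim, §3 Lemma (3.6) (p0007 L16–L28)] [cite: Humphreys1972, §19.1 Proposition (a)] -/
theorem IsRiemannForm.exists_injective_lieHom_center_hodgeGroupComplexLie_of_finite_hodgeGroupCProdInr
    {η₁ : E₁ [⋀^Fin 2]→L[ℝ] ℝ} (hη₁ : IsRiemannForm Φ₁ η₁) [h₂ : LieAlgebra.IsSolvable (hodgeGroupComplexLie Φ₂)]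
    (hK : ((hodgeGroupCProdInr Φ₁ Φ₂ : Subgroup (SpecialLinearGroup ι₂ ℂ)) : Set (SpecialLinearGroup ι₂ ℂ)).Finite) :
    ∃ j : hodgeGroupComplexLie Φ₂ →ₗ⁅ℂ⁆ LieAlgebra.center ℂ (hodgeGroupComplexLie Φ₁), Function.Injective j := by
  have h₁ := hη₁.hasCentralRadical_hodgeGroupComplexLie
  rw [hodgeGroupComplexLie_eq_lieSubalgebraGL Φ₁] at h₁ ⊢
  rw [hodgeGroupComplexLie_eq_lieSubalgebraGL Φ₂] at h₂ ⊢
  haveI := h₁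
  exact exists_injective_lieHom_center_of_finite_hodgeGroupCProdInr Φ₁ Φ₂ hK

/-- Polarised form: `K₂` finite and `𝔥𝔤_ℂ(X₂)` solvable ⟹ `dim Hg(X₂) ≤ dim_ℂ 𝔷(𝔥𝔤_ℂ X₁)` (the `K₂`-finite case of g41-#2's
`dim Hg(X₁) + dim Hg(X₂) ≤ dim Hg(X₁ × X₂) + dim 𝔷(𝔥𝔤_ℂ X₁)`). [cite: MoonenZarhin1999LowDim, §3 Lemma (3.6) (p0007 L16–L28)]
[cite: Springer1998, 5.3.2 and 4.4.5–4.4.7] -/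
theorem IsRiemannForm.zdim_le_finrank_center_hodgeGroupComplexLie_of_finite_hodgeGroupCProdInr
    {η₁ : E₁ [⋀^Fin 2]→L[ℝ] ℝ} (hη₁ : IsRiemannForm Φ₁ η₁) [LieAlgebra.IsSolvable (hodgeGroupComplexLie Φ₂)]
    (hK : ((hodgeGroupCProdInr Φ₁ Φ₂ : Subgroup (SpecialLinearGroup ι₂ ℂ)) : Set (SpecialLinearGroup ι₂ ℂ)).Finite) :
    (isZConnected_map_toGL_hodgeGroupC Φ₂).zdim ≤ Module.finrank ℂ (LieAlgebra.center ℂ (hodgeGroupComplexLie Φ₁)) := by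
  have h := hη₁.zdim_add_zdim_le_zdim_prod_add_finrank_center_of_isSolvable Φ₁ Φ₂
  have hz := zdim_map_toGL_hodgeGroupC_prod_eq_left_of_finite Φ₁ Φ₂ hK
  omega

/-- **THE ONE-DIMENSIONAL CASE (Moonen–Zarhin (3.6) in rank one ∕ Prop. (3.8) shadow): `X₁` polarised, `dim Hg(X₂) = 1` and
`Hg(X₁ × X₂) ≠ Hg(X₁) × Hg(X₂) ⟹ 𝔥𝔤_ℂ(X₂)` EMBEDS INTO THE CENTRE `𝔷(𝔥𝔤_ℂ X₁)`** ("there is a homomorphism `U_k → Z` with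
finite kernel"). [cite: MoonenZarhin1999LowDim, §3 Lemma (3.6) (p0007 L16–L28) and Proposition (3.8) (p0007 L55–L73)] -/
theorem IsRiemannForm.exists_injective_lieHom_center_hodgeGroupComplexLie_of_ne_of_zdim_eq_one
    {η₁ : E₁ [⋀^Fin 2]→L[ℝ] ℝ} (hη₁ : IsRiemannForm Φ₁ η₁) (h : (isZConnected_map_toGL_hodgeGroupC Φ₂).zdim = 1)
    (hne : hodgeGroupC (prodPeriod Φ₁ Φ₂) ≠ blockDiagProd (hodgeGroupC Φ₁) (hodgeGroupC Φ₂)) :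
    ∃ j : hodgeGroupComplexLie Φ₂ →ₗ⁅ℂ⁆ LieAlgebra.center ℂ (hodgeGroupComplexLie Φ₁), Function.Injective j := by
  haveI := isSolvable_hodgeGroupComplexLie_of_zdim_le_one Φ₂ h.le
  exact hη₁.exists_injective_lieHom_center_hodgeGroupComplexLie_of_finite_hodgeGroupCProdInr Φ₁ Φ₂
    ((hodgeGroupC_prod_ne_blockDiagProd_iff_finite_hodgeGroupCProdInr_of_zdim_eq_one Φ₁ Φ₂ h).1 hne)

/-- The same for the surjection `𝔷(𝔥𝔤_ℂ X₁) ↠ 𝔥𝔤_ℂ(X₂)`. [cite: MoonenZarhin1999LowDim, §3 Lemma (3.6) (p0007 L16–L28) and Proposition (3.8) (p0007 L55–L73)] -/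
theorem IsRiemannForm.exists_surjective_lieHom_center_hodgeGroupComplexLie_of_ne_of_zdim_eq_one
    {η₁ : E₁ [⋀^Fin 2]→L[ℝ] ℝ} (hη₁ : IsRiemannForm Φ₁ η₁) (h : (isZConnected_map_toGL_hodgeGroupC Φ₂).zdim = 1)
    (hne : hodgeGroupC (prodPeriod Φ₁ Φ₂) ≠ blockDiagProd (hodgeGroupC Φ₁) (hodgeGroupC Φ₂)) :
    ∃ ψ : LieAlgebra.center ℂ (hodgeGroupComplexLie Φ₁) →ₗ⁅ℂ⁆ hodgeGroupComplexLie Φ₂, Function.Surjective ψ := by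
  haveI := isSolvable_hodgeGroupComplexLie_of_zdim_le_one Φ₂ h.le
  exact hη₁.exists_surjective_lieHom_center_hodgeGroupComplexLie_of_finite_hodgeGroupCProdInr Φ₁ Φ₂
    ((hodgeGroupC_prod_ne_blockDiagProd_iff_finite_hodgeGroupCProdInr_of_zdim_eq_one Φ₁ Φ₂ h).1 hne)

/-- Abelian-variety form: `X₁` an abelian variety, `dim Hg(X₂) = 1`, non-split ⟹ `𝔥𝔤_ℂ(X₂) ↪ 𝔷(𝔥𝔤_ℂ X₁)`.
[cite: MoonenZarhin1999LowDim, §3 Lemma (3.6) (p0007 L16–L28) and Proposition (3.8) (p0007 L55–L73)] -/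
theorem IsAbelianVariety.exists_injective_lieHom_center_hodgeGroupComplexLie_of_ne_of_zdim_eq_one
    (hX₁ : IsAbelianVariety Φ₁) (h : (isZConnected_map_toGL_hodgeGroupC Φ₂).zdim = 1)
    (hne : hodgeGroupC (prodPeriod Φ₁ Φ₂) ≠ blockDiagProd (hodgeGroupC Φ₁) (hodgeGroupC Φ₂)) :
    ∃ j : hodgeGroupComplexLie Φ₂ →ₗ⁅ℂ⁆ LieAlgebra.center ℂ (hodgeGroupComplexLie Φ₁), Function.Injective j := by
  obtain ⟨η₁, hη₁⟩ := hX₁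
  exact hη₁.exists_injective_lieHom_center_hodgeGroupComplexLie_of_ne_of_zdim_eq_one Φ₁ Φ₂ h hne

end ComplexTorus

end Literature.Geometry.Kaehler
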